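/-
Copyright (c) 2026. All rights reserved.
Released under Apache 2.0 license as described in the file LICENSE.
Authors: abc-iut cell, seat abc-iut-w5-d116 (gen 6).
-/
import Mathlib.RingTheory.RootsOfUnity.AlgebraicallyClosed
import Mathlib.FieldTheory.Galois.Infinite
import Mathlib.RingTheory.DedekindDomain.AdicValuation
import Mathlib.NumberTheory.NumberField.Basic
import Literature.AnabelianGeometry.AbsoluteAnabelian.AbsTopIII.KummerFaithfulProofs
import Literature.NumberTheory.GaloisRepresentations.AbsGaloisGroup
import Literature.NumberTheory.GaloisRepresentations.GaloisCohomology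
import HarnessLib

/-!
# [AbsTopIII] Cor 5.2 (ii) at the GENUINE global arithmetic data of a number field, I: a `G_F`-equivariant
# multiplicative automorphism of `F̄ˣ` is the identity or the inversion (row «COR52II-NF-MODEL»)

S. Mochizuki, *Topics in absolute anabelian geometry III* [MochizukiAbsTopIII2015], Cor 5.2 (ii) p. 119 (kurims
manuscript `paper:url-5493eb38cbb7`): for a global `T`-pair, `T ∈ {TF, TM}`, "there is a unique [hence, in
particular, there exists a functorial — relative to `Th⊚_T` — algorithm for constructing the] isomorphism
`μ_Ẑ(M⊚_TM) ⥲ μ_Ẑ(Π)` of `Π`-modules that is compatible […] with the isomorphisms `μ_Ẑ((M_v)_TM) ⥲ μ_Ẑ(Π_v)`";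
Prop 3.3 (i) p. 73: for `T = TLG` the cyclotome isomorphism "is only determined up to a `{±1}`-multiple".

The cell types Cor 5.2 (ii) as the schema `CyclotomeIsoUnique` over an abstract `TPairVocabulary`
(`TPairs.lean`, abc-iut-L4-t3; FACT-LIST F-0186; universal closure refuted / degenerate model witnessed,
`TPairsCyclotomeSchemaWitnesses`, `TPairsTrivialContext`).  THIS PROOF-ONLY FILE and its sequel
`NumberFieldCyclotomeRigidityCorollaries.lean` (abc-iut-w5-d116, L4-lead RULING #6f row «COR52II-NF-MODEL»; no
definitions, no named facts) prove the RIGIDITY CONTENT of the uniqueness/functoriality clause at the GENUINE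
global arithmetic data of a number field `F` — `G_F = Field.absoluteGaloisGroup F` acting on `F̄ = AlgebraicClosure F`
and on `F̄ˣ` (tree instance `Field.absoluteGaloisGroup.instMulDistribMulActionUnits`):

* `nfUnits_mulEquiv_rootsOfUnity_exponent`, `nfUnits_equivariant_rootsOfUnity_sign` — SIGN LEMMA: a
  `G_F`-equivariant multiplicative automorphism `β` of `F̄ˣ` acts on ALL roots of unity by one sign, `ζ ↦ ζ^{±1}`.
  Proof (number-field twin of the MLF argument of `AbsTopIII/EquivariantSignRigidity.lean`, abc-iut-L6-d1 /
  abc-iut-L6-t21): `β` acts on `μ_n` by a unit exponent `a_n`; for `π ∈ F` a uniformizer at a prime `𝔭` of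
  `𝓞_F` (`HeightOneSpectrum.valuation`, `WithZero.log` orders) and an `n`-th root `y ∈ F̄`, `β(y)/y^{a_n}` is
  `G_F`-invariant, so lies in `F` (Krull, `InfiniteGalois.mem_range_algebraMap_iff_fixed`), whence
  `a_n ≡ A (mod n)` for the ONE integer `A = -ord_𝔭(β π)` and every `n`; injectivity of `β` on `-1` and on a
  primitive `|A|`-th root forces `A = ±1`.
* `nfUnits_equivariant_eq_self_of_rootsOfUnity` — KUMMER-CLASS STEP: a `G_F`-equivariant multiplicative self-map
  of `F̄ˣ` fixing every root of unity is the identity (`β x / x` has `Gal(F̄/F(x))`-fixed `n`-th roots `β y / y`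
  for all `n`, and `⋂_n (F(x)ˣ)^n = 1` — [AbsTopIII] Rmk 1.5.3 (i), the tree's
  `AbsTopIII.divisibleElementsTrivial_units_of_numberField`; the same instance as abc-iut-L4-d2's
  `units_eq_one_of_fixed_of_forall_exists_fixed_pow`, `NumberFieldGlobalKummerInjectiveProofs.lean`).
* `nfUnits_equivariant_eq_id_or_inv` — **a `G_F`-equivariant multiplicative automorphism of `F̄ˣ` is the identity
  or the inversion** (global twin of `MLFClosure.nonZeroDivisors_equivariant_eq_id_or_inv`).

The sequel draws the consequences for the cyclotome `μ_Ẑ(F̄ˣ) = Λ(F̄ˣ)`: `Λ(β) = ±1` (the `{±1}` of Prop 3.3 (i),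
`T = TLG`, which Cor 5.2 (ii) excludes), `Λ = id` for `G_F`-equivariant RING automorphisms of `F̄` (`T = TF`:
rigid), and `H⁰(U, Ẑ(1)) = 1` for `U ≤ G_F` of finite index.

HONEST SCOPE («NF instance of the schema; genuine `(W_F, C_F)` context not constructed»): model/instance level for
the arithmetic SHADOW `Π = G_F` (`Δ = 1`); the genuine `Π = Π_X` of an elliptically admissible curve and the
`TPairVocabulary` instance need the §5 `GlobalAnabelianContext` (campaign L, GAP G-L4d2g4-1).  No local/global
class field theory and no cohomology is used; any universe.  Classical (Kummer theory over number fields);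
nothing here bears on [IUTchIII] Cor. 3.12 or takes a side.
-/

noncomputable section

open scoped Classical

namespace Literature.AnabelianGeometry.AbsoluteAnabelian

open Field IsDedekindDomain NumberField

universe u

variable (F : Type u) [Field F]

/-! ### Preliminaries on `G_F ↷ F̄`, `F̄ˣ` -/

/-- The action of `σ ∈ G_F` on a unit of `F̄`, on underlying elements, is the `F`-algebra automorphism
`toAlgEquiv σ` ("equipped with a continuous action by `Π`", Def 5.1 (v)). [cite: MochizukiAbsTopIII2015, Def 5.1 (v) p.117] -/
theorem nfUnits_coe_smul (σ : absoluteGaloisGroup F) (x : (AlgebraicClosure F)ˣ) :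
    ((σ • x : (AlgebraicClosure F)ˣ) : AlgebraicClosure F) =
      absoluteGaloisGroup.toAlgEquiv F σ (x : AlgebraicClosure F) := rfl

/-- `G_F` fixes the image of `F` in `F̄ˣ`. [cite: MochizukiAbsTopIII2015, Def 5.1 (v) p.117] -/
theorem nfUnits_smul_eq_of_mem_range (σ : absoluteGaloisGroup F) (x : (AlgebraicClosure F)ˣ)
    (hx : (x : AlgebraicClosure F) ∈ Set.range (algebraMap F (AlgebraicClosure F))) : σ • x = x := by
  obtain ⟨a, ha⟩ := hx
  apply Units.ext
  rw [nfUnits_coe_smul, ← ha, AlgEquiv.commutes]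

/-- An element of `F̄` fixed by every `σ ∈ G_F` lies in `F` (infinite Galois theory: `F̄/F` is Galois in
characteristic `0`; the Krull step of the proof of Cor 5.2 (ii) at the genuine data). [cite: MochizukiAbsTopIII2015, Cor 5.2 (ii) p.119] -/
theorem nf_mem_range_algebraMap_of_forall_smul_eq [CharZero F] (z : AlgebraicClosure F)
    (hz : ∀ σ : absoluteGaloisGroup F, σ • z = z) :
    z ∈ Set.range (algebraMap F (AlgebraicClosure F)) := by
  haveI : IsGalois F (AlgebraicClosure F) := IsAlgClosure.isGalois F (AlgebraicClosure F)
  exact (InfiniteGalois.mem_range_algebraMap_iff_fixed z).mpr fun f =>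
    hz ((absoluteGaloisGroup.toAlgEquiv F).symm f)

/-! ### The sign of an equivariant automorphism on the roots of unity -/

/-- **Exponents.** A multiplicative automorphism `β` of `F̄ˣ` acts on the `n`-th roots of unity through ONE
exponent `a` (`μ_n(F̄)` is cyclic, generated by a primitive root, and `β` preserves `μ_n`).  (Equivariance is not
needed.) [cite: MochizukiAbsTopIII2015, Cor 5.2 (ii) p.119] -/
theorem nfUnits_mulEquiv_rootsOfUnity_exponent [CharZero F]
    (β : (AlgebraicClosure F)ˣ ≃* (AlgebraicClosure F)ˣ) (n : ℕ) (hn : 0 < n) :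
    ∃ a : ℕ, ∀ ζ : (AlgebraicClosure F)ˣ, ζ ^ n = 1 → β ζ = ζ ^ a := by
  haveI : CharZero (AlgebraicClosure F) :=
    charZero_of_injective_algebraMap (algebraMap F (AlgebraicClosure F)).injective
  haveI : NeZero n := ⟨hn.ne'⟩
  obtain ⟨ζ₀, hζ₀⟩ := HasEnoughRootsOfUnity.exists_primitiveRoot (AlgebraicClosure F) n
  set z₀ : (AlgebraicClosure F)ˣ := (hζ₀.isUnit hn.ne').unit with hz₀
  have hz₀prim : IsPrimitiveRoot z₀ n := hζ₀.isUnit_unit hn.ne'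
  have hβz₀ : β z₀ ∈ rootsOfUnity n (AlgebraicClosure F) := by
    rw [mem_rootsOfUnity, ← map_pow, hz₀prim.pow_eq_one, map_one]
  obtain ⟨a, -, ha⟩ := hz₀prim.eq_pow_of_mem_rootsOfUnity hβz₀
  refine ⟨a, fun ζ hζ => ?_⟩
  obtain ⟨i, -, hi⟩ := hz₀prim.eq_pow_of_mem_rootsOfUnity ((mem_rootsOfUnity n ζ).mpr hζ)
  rw [← hi, map_pow, ← ha, ← pow_mul, ← pow_mul, mul_comm]

/-- **Sign lemma** (number-field twin of `MLFClosure.nonZeroDivisors_equivariant_rootsOfUnity_sign`).  A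
`G_F`-equivariant multiplicative automorphism `β` of `F̄ˣ` acts on all roots of unity of `F̄` either trivially or
by inversion: the exponent by which `β` acts on `μ_n` is congruent mod `n`, for every `n`, to minus the `𝔭`-order
of `β(π) ∈ F` for a uniformizer `π ∈ F` at a prime `𝔭` of `𝓞_F`, and that integer is `±1`.
[cite: MochizukiAbsTopIII2015, Cor 5.2 (ii) p.119] -/
theorem nfUnits_equivariant_rootsOfUnity_sign [NumberField F]
    (β : (AlgebraicClosure F)ˣ ≃* (AlgebraicClosure F)ˣ)
    (hβ : ∀ (σ : absoluteGaloisGroup F) (x : (AlgebraicClosure F)ˣ), β (σ • x) = σ • β x) :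
    (∀ (ζ : (AlgebraicClosure F)ˣ) (n : ℕ), 0 < n → ζ ^ n = 1 → β ζ = ζ) ∨
    (∀ (ζ : (AlgebraicClosure F)ˣ) (n : ℕ), 0 < n → ζ ^ n = 1 → β ζ = ζ⁻¹) := by
  haveI : CharZero (AlgebraicClosure F) :=
    charZero_of_injective_algebraMap (algebraMap F (AlgebraicClosure F)).injective
  set K := AlgebraicClosure F with hKdef
  -- (S1) exponents
  have S1 := nfUnits_mulEquiv_rootsOfUnity_exponent F β
  -- (S2) a prime `𝔭` of `𝓞_F`, its valuation, a uniformizer `π ∈ F`, and `b := β(π) ∈ F`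
  obtain ⟨M, hM⟩ := Ideal.exists_maximal (𝓞 F)
  let v : HeightOneSpectrum (𝓞 F) := ⟨M, hM.isPrime, NeZero.ne M⟩
  obtain ⟨π₀, hπ₀⟩ := v.valuation_exists_uniformizer F
  have hπ₀0 : π₀ ≠ 0 := by
    intro h
    rw [h, map_zero] at hπ₀
    exact WithZero.zero_ne_coe hπ₀
  have hπK0 : algebraMap F K π₀ ≠ 0 := (map_ne_zero_iff _ (algebraMap F K).injective).mpr hπ₀0
  set pK : Kˣ := Units.mk0 (algebraMap F K π₀) hπK0 with hpK
  have hσpK : ∀ σ : absoluteGaloisGroup F, σ • pK = pK := fun σ =>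
    nfUnits_smul_eq_of_mem_range F σ pK ⟨π₀, by rw [hpK, Units.val_mk0]⟩
  have hfixβπ : ∀ σ : absoluteGaloisGroup F, σ • ((β pK : Kˣ) : K) = (β pK : K) := by
    intro σ
    have h := congrArg (fun u : Kˣ => (u : K)) (hβ σ pK)
    simp only [hσpK] at h
    rw [nfUnits_coe_smul] at h
    rw [absoluteGaloisGroup.smul_def]
    exact h.symm
  obtain ⟨b, hb⟩ := nf_mem_range_algebraMap_of_forall_smul_eq F _ hfixβπ
  have hb0 : b ≠ 0 := by
    intro h; rw [h, map_zero] at hb; exact (β pK).ne_zero hb.symm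
  -- integer orders at `𝔭`
  let ord : F → ℤ := fun x => WithZero.log (v.valuation F x)
  have hord_mul : ∀ x y : F, x ≠ 0 → y ≠ 0 → ord (x * y) = ord x + ord y := by
    intro x y hx hy
    simp only [ord, map_mul]
    exact WithZero.log_mul ((Valuation.ne_zero_iff _).mpr hx) ((Valuation.ne_zero_iff _).mpr hy)
  have hord_pow : ∀ (x : F) (m : ℕ), ord (x ^ m) = m * ord x := by
    intro x m
    simp only [ord, map_pow, WithZero.log_pow, nsmul_eq_mul]
  have hordπ : ord π₀ = -1 := by simp only [ord, hπ₀, WithZero.log_exp]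
  set A : ℤ := - ord b with hA
  -- (S3) the congruence `a_n ≡ A (mod n)`
  have S3 : ∀ n : ℕ, 0 < n → ∀ a : ℕ, (∀ ζ : Kˣ, ζ ^ n = 1 → β ζ = ζ ^ a) →
      ∃ t : ℤ, (a : ℤ) = A + n * t := by
    intro n hn a ha
    obtain ⟨y, hy⟩ := IsAlgClosed.exists_pow_nat_eq (algebraMap F K π₀) hn
    have hy0 : y ≠ 0 := by
      rintro rfl; rw [zero_pow hn.ne'] at hy; exact hπK0 hy.symm
    set yU : Kˣ := Units.mk0 y hy0 with hyU
    have hyUn : yU ^ n = pK := Units.ext (by simp [hyU, hpK, hy])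
    set Y : K := ((β yU : Kˣ) : K) with hYdef
    have hY0 : Y ≠ 0 := (β yU).ne_zero
    have hYn : Y ^ n = algebraMap F K b := by
      rw [hYdef, ← Units.val_pow_eq_pow_val, ← map_pow, hyUn, hb]
    -- the Galois action on `Y`: `σ Y = (σ y / y) ^ a * Y`
    have hσy0 : ∀ σ : absoluteGaloisGroup F, σ • y ≠ 0 := fun σ => by
      rw [absoluteGaloisGroup.smul_def]; exact (map_ne_zero_iff _ (AlgEquiv.injective _)).mpr hy0
    have hσY : ∀ σ : absoluteGaloisGroup F, σ • Y = (σ • y / y) ^ a * Y := by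
      intro σ
      have hξn : (σ • y / y) ^ n = 1 := by
        rw [div_pow, ← smul_pow', hy, absoluteGaloisGroup.smul_def, AlgEquiv.commutes, div_self hπK0]
      have hξ0 : σ • y / y ≠ 0 := div_ne_zero (hσy0 σ) hy0
      set ξU : Kˣ := Units.mk0 (σ • y / y) hξ0 with hξU
      have hξUn : ξU ^ n = 1 := Units.ext (by simp [hξU, hξn])
      have hσyU : σ • yU = ξU * yU := Units.ext (by
        rw [nfUnits_coe_smul, ← absoluteGaloisGroup.smul_def]
        simp [hξU, hyU, div_mul_cancel₀ _ hy0])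
      have h1 := hβ σ yU
      rw [hσyU, map_mul, ha ξU hξUn] at h1
      -- h1 : ξU ^ a * β yU = σ • β yU
      have h2 := congrArg (fun u : Kˣ => (u : K)) h1
      simp only [Units.val_mul, Units.val_pow_eq_pow_val, nfUnits_coe_smul] at h2
      rw [absoluteGaloisGroup.smul_def, ← hYdef] at *
      rw [← h2, hξU, Units.val_mk0, absoluteGaloisGroup.smul_def]
    have hfixZ : ∀ σ : absoluteGaloisGroup F, σ • (Y / y ^ a) = Y / y ^ a := by
      intro σ
      have hξ0 : σ • y / y ≠ 0 := div_ne_zero (hσy0 σ) hy0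
      calc σ • (Y / y ^ a) = σ • Y / (σ • y) ^ a := by
            rw [absoluteGaloisGroup.smul_def, absoluteGaloisGroup.smul_def, absoluteGaloisGroup.smul_def,
              map_div₀, map_pow]
        _ = ((σ • y / y) ^ a * Y) / ((σ • y / y) ^ a * y ^ a) := by
            rw [hσY σ, ← mul_pow, div_mul_cancel₀ _ hy0]
        _ = Y / y ^ a := mul_div_mul_left _ _ (pow_ne_zero _ hξ0)
    obtain ⟨c, hc⟩ := nf_mem_range_algebraMap_of_forall_smul_eq F _ hfixZ
    have hc0 : c ≠ 0 := by
      intro h; rw [h, map_zero] at hc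
      exact div_ne_zero hY0 (pow_ne_zero _ hy0) hc.symm
    -- `b = c ^ n * π₀ ^ a` in `F`
    have hbcπ : b = c ^ n * π₀ ^ a := by
      apply (algebraMap F K).injective
      rw [map_mul, map_pow, map_pow, hc, div_pow, ← pow_mul, mul_comm a n, pow_mul, hy,
        div_mul_cancel₀ _ (pow_ne_zero _ hπK0), hYn]
    have hordb : ord b = n * ord c + a * ord π₀ := by
      rw [hbcπ, hord_mul _ _ (pow_ne_zero _ hc0) (pow_ne_zero _ hπ₀0), hord_pow, hord_pow]
    refine ⟨ord c, ?_⟩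
    rw [hA, hordb, hordπ]
    ring
  -- (S4) `A = ±1`
  have hinj : ∀ ζ : Kˣ, β ζ = 1 → ζ = 1 := fun ζ h => β.injective (h.trans (map_one β).symm)
  have hA1 : A = 1 ∨ A = -1 := by
    have htri : A = 1 ∨ A = -1 ∨ (A = 0 ∨ 2 ≤ A.natAbs) := by omega
    rcases htri with h | h | hrest
    · exact Or.inl h
    · exact Or.inr h
    exfalso
    rcases hrest with hA0 | hA2
    · obtain ⟨a, ha⟩ := S1 2 two_pos
      obtain ⟨t, ht⟩ := S3 2 two_pos a ha
      have hdvd : (2 : ℤ) ∣ (a : ℤ) := ⟨t, by rw [ht, hA0]; ring⟩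
      have heven : Even a := even_iff_two_dvd.mpr (by exact_mod_cast hdvd)
      have h1 : β (-1) = 1 := by rw [ha (-1) (by simp), heven.neg_one_pow]
      have h2 := hinj (-1) h1
      have h3 : ((-1 : Kˣ) : K) = ((1 : Kˣ) : K) := by rw [h2]
      norm_num at h3
    · set m := A.natAbs with hmdef
      have hm2 : 2 ≤ m := hA2
      have hmpos : 0 < m := by omega
      haveI : NeZero m := ⟨hmpos.ne'⟩
      obtain ⟨ζ₁, hζ₁⟩ := HasEnoughRootsOfUnity.exists_primitiveRoot K m
      obtain ⟨a, ha⟩ := S1 m hmpos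
      obtain ⟨t, ht⟩ := S3 m hmpos a ha
      set zM : Kˣ := (hζ₁.isUnit hmpos.ne').unit with hzM
      have hzMprim : IsPrimitiveRoot zM m := hζ₁.isUnit_unit hmpos.ne'
      have hmA : (m : ℤ) ∣ A := by rw [hmdef]; exact Int.natAbs_dvd.mpr dvd_rfl
      have hma' : (m : ℤ) ∣ (a : ℤ) := by
        rw [ht]; exact dvd_add hmA (dvd_mul_right _ _)
      have hma : m ∣ a := by exact_mod_cast hma'
      have h1 : β zM = 1 := by
        rw [ha zM hzMprim.pow_eq_one]
        exact (hzMprim.pow_eq_one_iff_dvd a).mpr hma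
      exact hzMprim.ne_one hm2 (hinj zM h1)
  -- (S5) conclusion
  rcases hA1 with hA1 | hA1
  · left
    intro ζ n hn hζ
    obtain ⟨a, ha⟩ := S1 n hn
    obtain ⟨t, ht⟩ := S3 n hn a ha
    rw [ha ζ hζ, ← zpow_natCast, ht, hA1, zpow_add, zpow_one, zpow_mul, zpow_natCast, hζ, one_zpow,
      mul_one]
  · right
    intro ζ n hn hζ
    obtain ⟨a, ha⟩ := S1 n hn
    obtain ⟨t, ht⟩ := S3 n hn a ha
    rw [ha ζ hζ, ← zpow_natCast, ht, hA1, zpow_add, zpow_neg_one, zpow_mul, zpow_natCast, hζ,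
      one_zpow, mul_one]


/-! ### The Kummer-class step and the dichotomy -/

/-- Equivariance read through `toAlgEquiv`: for `τ : F̄ ≃ₐ[F] F̄` and a unit `u`, `β` applied to `τ u` is `τ (β u)`
on underlying elements. [cite: MochizukiAbsTopIII2015, Cor 5.2 (ii) p.119] -/
theorem nfUnits_equivariant_algEquiv (β : (AlgebraicClosure F)ˣ →* (AlgebraicClosure F)ˣ)
    (hβ : ∀ (σ : absoluteGaloisGroup F) (x : (AlgebraicClosure F)ˣ), β (σ • x) = σ • β x)
    (τ : AlgebraicClosure F ≃ₐ[F] AlgebraicClosure F) (u v : (AlgebraicClosure F)ˣ)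
    (huv : (v : AlgebraicClosure F) = τ (u : AlgebraicClosure F)) :
    ((β v : (AlgebraicClosure F)ˣ) : AlgebraicClosure F) = τ ((β u : (AlgebraicClosure F)ˣ) : AlgebraicClosure F) := by
  have hv : v = ((absoluteGaloisGroup.toAlgEquiv F).symm τ) • u := Units.ext (by
    rw [nfUnits_coe_smul, MulEquiv.apply_symm_apply]; exact huv)
  rw [hv, hβ, nfUnits_coe_smul, MulEquiv.apply_symm_apply]

/-- **Kummer-class step** (number-field twin of `MLFClosure.submonoid_equivariant_eq_self`): a `G_F`-equivariant
multiplicative self-map `β` of `F̄ˣ` fixing every root of unity is the identity.  For `x ∈ F̄ˣ` put `k' := F(x)`,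
`H := Gal(F̄/k')`; for an `n`-th root `y` of `x` the cocycle `σ ↦ σy/y` (`σ ∈ H`) is `μ_n`-valued and `β` fixes
`μ_n`, so `β(y)/y` is `H`-invariant, i.e. lies in `k'` (Krull), and `(β y/y)^n = β x/x`; hence `β x/x ∈ ⋂_n (k'ˣ)^n`,
which is trivial for the number field `k'` ([AbsTopIII] Rmk 1.5.3 (i), tree
`AbsTopIII.divisibleElementsTrivial_units_of_numberField`). [cite: MochizukiAbsTopIII2015, Cor 5.2 (ii) p.119] -/
theorem nfUnits_equivariant_eq_self_of_rootsOfUnity [NumberField F]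
    (β : (AlgebraicClosure F)ˣ →* (AlgebraicClosure F)ˣ)
    (hβ : ∀ (σ : absoluteGaloisGroup F) (x : (AlgebraicClosure F)ˣ), β (σ • x) = σ • β x)
    (hμ : ∀ (ζ : (AlgebraicClosure F)ˣ) (n : ℕ), 0 < n → ζ ^ n = 1 → β ζ = ζ) :
    ∀ x : (AlgebraicClosure F)ˣ, β x = x := by
  haveI : IsGalois F (AlgebraicClosure F) := IsAlgClosure.isGalois F (AlgebraicClosure F)
  set K := AlgebraicClosure F with hKdef
  intro x
  have hx0 : (x : K) ≠ 0 := x.ne_zero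
  have hβx0 : ((β x : Kˣ) : K) ≠ 0 := (β x).ne_zero
  -- the finite level `k' = F(x)`, a number field, and its Galois group `H`
  set k' : IntermediateField F K := IntermediateField.adjoin F {(x : K)} with hk'
  haveI : FiniteDimensional F k' :=
    IntermediateField.adjoin.finiteDimensional (Algebra.IsIntegral.isIntegral (x : K))
  haveI : NumberField k' := NumberField.of_module_finite F k'
  set H : Subgroup (K ≃ₐ[F] K) := k'.fixingSubgroup with hH
  have hxk : (x : K) ∈ k' := IntermediateField.subset_adjoin F {(x : K)} (Set.mem_singleton _)
  have hfix : ∀ z : K, (∀ σ ∈ H, σ z = z) → z ∈ k' := by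
    intro z hz
    have hz' : z ∈ IntermediateField.fixedField H := (IntermediateField.mem_fixedField_iff H z).mpr hz
    rwa [hH, InfiniteGalois.fixedField_fixingSubgroup] at hz'
  have hHx : ∀ σ ∈ H, σ (x : K) = x := fun σ hσ =>
    (IntermediateField.mem_fixingSubgroup_iff _ _).mp hσ _ hxk
  -- `β x ∈ k'`
  have hβxk : ((β x : Kˣ) : K) ∈ k' := by
    refine hfix _ fun σ hσ => ?_
    exact (nfUnits_equivariant_algEquiv F β hβ σ x x (hHx σ hσ).symm).symm
  -- `u := β x / x ∈ k'` has `n`-th roots in `k'` for every `n`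
  set u : K := ((β x : Kˣ) : K) / x with hu
  have huk : u ∈ k' := div_mem hβxk hxk
  have hu0 : u ≠ 0 := div_ne_zero hβx0 hx0
  have hun : ∀ n : ℕ, 0 < n → ∃ w : K, w ∈ k' ∧ w ^ n = u := by
    intro n hn
    obtain ⟨y, hyx⟩ := IsAlgClosed.exists_pow_nat_eq (x : K) hn
    have hy0 : y ≠ 0 := by
      rintro rfl; rw [zero_pow hn.ne'] at hyx; exact hx0 hyx.symm
    set yU : Kˣ := Units.mk0 y hy0 with hyU
    have hyUn : yU ^ n = x := Units.ext (by simp [hyU, hyx])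
    refine ⟨((β yU : Kˣ) : K) / y, hfix _ fun σ hσ => ?_, ?_⟩
    · -- the cocycle value `ζ = σ y / y` is an `n`-th root of unity, fixed by `β`
      have hσy0 : σ y ≠ 0 := (map_ne_zero_iff σ σ.injective).mpr hy0
      set ζ : K := σ y / y with hζ
      have hζn : ζ ^ n = 1 := by rw [hζ, div_pow, ← map_pow, hyx, hHx σ hσ, div_self hx0]
      have hζ0 : ζ ≠ 0 := div_ne_zero hσy0 hy0
      set ζU : Kˣ := Units.mk0 ζ hζ0 with hζU
      have hζUn : ζU ^ n = 1 := Units.ext (by simp [hζU, hζn])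
      have hβζ : β ζU = ζU := hμ ζU n hn hζUn
      have hσy : σ y = ζ * y := by rw [hζ, div_mul_cancel₀ _ hy0]
      have h1 := nfUnits_equivariant_algEquiv F β hβ σ yU (ζU * yU)
        (by rw [Units.val_mul]; simp [hζU, hyU, hσy])
      rw [map_mul, hβζ, Units.val_mul] at h1
      -- h1 : ζ * β yU = σ (β yU)
      have h1' : σ ((β yU : Kˣ) : K) = ζ * ((β yU : Kˣ) : K) := by rw [← h1, hζU, Units.val_mk0]
      rw [map_div₀, h1', hσy, mul_div_mul_left _ _ hζ0]
    · rw [div_pow, hu, ← hyx, ← Units.val_pow_eq_pow_val, ← map_pow, hyUn]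
  -- `⋂_n (k'ˣ)^n = 1` for the number field `k'`
  have hu1 : u = 1 := by
    have hDT := AbsTopIII.divisibleElementsTrivial_units_of_numberField (k' : Type u)
    have huk0 : (⟨u, huk⟩ : k') ≠ 0 := fun h => hu0 (congrArg Subtype.val h)
    set uK : (k' : Type u)ˣ := Units.mk0 ⟨u, huk⟩ huk0 with huK
    have key : uK = 1 := hDT.eq_one_of_forall_exists_pow uK fun n hn => by
      obtain ⟨w, hwk, hwn⟩ := hun n hn
      have hw0 : (⟨w, hwk⟩ : k') ≠ 0 := by
        intro h
        have : w = 0 := congrArg Subtype.val h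
        rw [this, zero_pow hn.ne'] at hwn
        exact hu0 hwn.symm
      refine ⟨Units.mk0 ⟨w, hwk⟩ hw0, Units.ext (Subtype.ext ?_)⟩
      simp [huK, hwn]
    have := congrArg (fun z : (k' : Type u)ˣ => ((z : k') : K)) key
    simpa [huK] using this
  apply Units.ext
  have : ((β x : Kˣ) : K) = u * x := by rw [hu, div_mul_cancel₀ _ hx0]
  rw [this, hu1, one_mul]

/-- **A `G_F`-equivariant multiplicative automorphism of `F̄ˣ` is the identity or the inversion `x ↦ x⁻¹`**
(number-field twin of `MLFClosure.nonZeroDivisors_equivariant_eq_id_or_inv`; sign lemma + Kummer-class step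
applied to `β`, resp. `β` followed by inversion). [cite: MochizukiAbsTopIII2015, Cor 5.2 (ii) p.119] -/
theorem nfUnits_equivariant_eq_id_or_inv [NumberField F]
    (β : (AlgebraicClosure F)ˣ ≃* (AlgebraicClosure F)ˣ)
    (hβ : ∀ (σ : absoluteGaloisGroup F) (x : (AlgebraicClosure F)ˣ), β (σ • x) = σ • β x) :
    (∀ x : (AlgebraicClosure F)ˣ, β x = x) ∨ (∀ x : (AlgebraicClosure F)ˣ, β x = x⁻¹) := by
  rcases nfUnits_equivariant_rootsOfUnity_sign F β hβ with h | h
  · exact Or.inl (nfUnits_equivariant_eq_self_of_rootsOfUnity F β.toMonoidHom hβ h)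
  · right
    -- `β' := inv ∘ β` is equivariant and fixes the roots of unity
    set β' : (AlgebraicClosure F)ˣ →* (AlgebraicClosure F)ˣ :=
      (MulEquiv.inv (AlgebraicClosure F)ˣ).toMonoidHom.comp β.toMonoidHom with hβ'
    have hβ'apply : ∀ x, β' x = (β x)⁻¹ := fun x => rfl
    have hβ'σ : ∀ (σ : absoluteGaloisGroup F) (x : (AlgebraicClosure F)ˣ), β' (σ • x) = σ • β' x := by
      intro σ x; rw [hβ'apply, hβ'apply, hβ, smul_inv']
    have hβ'μ : ∀ (ζ : (AlgebraicClosure F)ˣ) (n : ℕ), 0 < n → ζ ^ n = 1 → β' ζ = ζ := by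
      intro ζ n hn hζ; rw [hβ'apply, h ζ n hn hζ, inv_inv]
    intro x
    have := nfUnits_equivariant_eq_self_of_rootsOfUnity F β' hβ'σ hβ'μ x
    rw [hβ'apply] at this
    rw [← inv_inv (β x), this]

end Literature.AnabelianGeometry.AbsoluteAnabelian

end
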